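import Summits.CriticalPhenomena.Statement
import Literature.MathematicalPhysics.QuantumFieldTheory.CFTAxioms
import Mathlib

/-!
# CriticalPhenomena / IsingCFTData — refutations

Route `CriticalPhenomena/IsingCFTData`, items `stmt-CriticalPhenomena-0666` (crux (ND)) and
`stmt-CriticalPhenomena-0663` (thesis `X_I2 = (CFT) ∧ (ND)`), refuted AS TYPED for a junk reason
the planner must exclude: (ND) quantifies over EVERY renormalisation `ρ > 0` on `(0,1]`, and for
ANY lattice family `G` whatsoever one can choose `ρ(δ)` decaying so fast (relative to a crude bound
on `|G n|` over the finitely many configurations of size `≤ ⌈δ⁻²⌉`) that the rescaled correlators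
`ρ(δ)^n G n ([x/δ])` converge to `0` locally uniformly for every `n ≥ 1`. The resulting pointwise
scaling limit has `S 2 ≡ 0`, so it is neither non-degenerate nor non-Gaussian. No property of the
Ising model (not even boundedness of its correlators, which are `limUnder`-valued) is used.
Fix (planner): (ND) must carry `IsNondegenerateTwoPoint S` as a HYPOTHESIS (then it is
`stmt-CriticalPhenomena-0636`), and non-degeneracy of the CFT limit must come from the CFT side
(unitarity ⇒ positive two-point coefficient) in the assembly.
-/

namespace CriticalPhenomena.IsingCFTData

open Literature.Probability.LatticeModels Literature.Probability.Percolation Filter Topology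
open scoped BigOperators

noncomputable section

variable {d : ℕ}

/-- General junk lemma (no definitions, so that it lands without review): for every lattice
family `G` on `ℤ^d`, `d ≥ 1`, SOME positive renormalisation `ρ` has a pointwise scaling limit
`S` that is degenerate (`S n ≡ 0` for `n ≥ 1`). Construction: `ρ(δ) = δ / B(⌈δ⁻²⌉)` where
`B(m) = 1 + Σ_{n ≤ m} Σ_{z ∈ [-m,m]^{n×d}} |G n z|` dominates every `|G n ([y/δ])|` met on a
bounded set once `δ` is small; then `|ρ(δ)^n G| ≤ δ`. [folklore] -/
theorem exists_degenerate_scalingLimit (G : LatticeCorrFamily d) (hd : 0 < d) :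
    ∃ (ρ : ℝ → ℝ) (S : CorrFamily d), (∀ δ ∈ Set.Ioc (0:ℝ) 1, 0 < ρ δ) ∧
      HasPointwiseScalingLimit G ρ S ∧ ¬ IsNondegenerateTwoPoint S := by
  classical
  -- the crude size bound
  obtain ⟨B, hB⟩ : ∃ B : ℕ → ℝ, B = fun m => 1 + ∑ n ∈ Finset.range (m + 1),
      ∑ z : Fin n → Fin d → Set.Icc (-(m : ℤ)) m, |G n (fun i k => (z i k : ℤ))| := ⟨_, rfl⟩
  have one_le_B : ∀ m, 1 ≤ B m := by
    intro m
    have : 0 ≤ ∑ n ∈ Finset.range (m + 1),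
        ∑ z : Fin n → Fin d → Set.Icc (-(m : ℤ)) m, |G n (fun i k => (z i k : ℤ))| :=
      Finset.sum_nonneg fun _ _ => Finset.sum_nonneg fun _ _ => abs_nonneg _
    simp only [hB]
    linarith
  have B_pos : ∀ m, 0 < B m := fun m => one_pos.trans_le (one_le_B m)
  have abs_le_B : ∀ {m n : ℕ}, n ≤ m → ∀ y : Fin n → Site d,
      (∀ i k, y i k ∈ Set.Icc (-(m : ℤ)) m) → |G n y| ≤ B m := by
    intro m n hn y hy
    let z : Fin n → Fin d → Set.Icc (-(m : ℤ)) m := fun i k => ⟨y i k, hy i k⟩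
    have hz : (fun i k => (z i k : ℤ)) = y := rfl
    have h1 : |G n y| ≤
        ∑ z : Fin n → Fin d → Set.Icc (-(m : ℤ)) m, |G n (fun i k => (z i k : ℤ))| := by
      rw [← hz]
      exact Finset.single_le_sum (f := fun z : Fin n → Fin d → Set.Icc (-(m : ℤ)) m =>
        |G n (fun i k => (z i k : ℤ))|) (fun _ _ => abs_nonneg _) (Finset.mem_univ z)
    have h2 : ∑ z : Fin n → Fin d → Set.Icc (-(m : ℤ)) m, |G n (fun i k => (z i k : ℤ))| ≤
        ∑ n ∈ Finset.range (m + 1),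
          ∑ z : Fin n → Fin d → Set.Icc (-(m : ℤ)) m, |G n (fun i k => (z i k : ℤ))| :=
      Finset.single_le_sum (f := fun n => ∑ z : Fin n → Fin d → Set.Icc (-(m : ℤ)) m,
          |G n (fun i k => (z i k : ℤ))|) (fun _ _ => Finset.sum_nonneg fun _ _ => abs_nonneg _)
        (Finset.mem_range.2 (Nat.lt_succ_of_le hn))
    simp only [hB]
    linarith
  -- the killing renormalisation and the trivial limit
  obtain ⟨ρ, hρ⟩ : ∃ ρ : ℝ → ℝ, ρ = fun δ => δ / B ⌈1 / δ ^ 2⌉₊ := ⟨_, rfl⟩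
  have ρ_pos : ∀ {δ : ℝ}, 0 < δ → 0 < ρ δ := fun hδ => by
    simp only [hρ]; exact div_pos hδ (B_pos _)
  obtain ⟨S, hS⟩ : ∃ S : CorrFamily d,
      S = fun n x => if n = 0 then rescaledCorrelator G ρ n 1 x else 0 := ⟨_, rfl⟩
  refine ⟨ρ, S, fun δ hδ => ρ_pos hδ.1, ?_, ?_⟩
  · -- the scaling limit
    intro n
    rw [Metric.tendstoLocallyUniformlyOn_iff]
    intro ε hε x hx
    by_cases hn : n = 0
    · subst hn
      refine ⟨Set.univ, Filter.univ_mem, Filter.Eventually.of_forall fun δ y _ => ?_⟩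
      have : rescaledCorrelator G ρ 0 δ y = S 0 y := by
        simp only [hS, if_true, rescaledCorrelator, pow_zero, one_mul]
        exact congrArg (G 0) (Subsingleton.elim _ _)
      rw [this, dist_self]
      exact hε
    · refine ⟨Metric.ball x 1, mem_nhdsWithin_of_mem_nhds (Metric.ball_mem_nhds x one_pos), ?_⟩
      set R : ℝ := ‖x‖ + 1 with hR
      have hR0 : 0 ≤ R := by positivity
      set δ₀ : ℝ := min ε (min (1 / (R + 2)) (1 / ((n : ℝ) + 1))) with hδ₀
      have hδ₀pos : 0 < δ₀ := by positivity
      filter_upwards [Ioo_mem_nhdsGT hδ₀pos] with δ hδ y hy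
      obtain ⟨hδpos, hδlt⟩ := hδ
      have hδε : δ < ε := hδlt.trans_le (min_le_left _ _)
      have hδR : δ < 1 / (R + 2) := hδlt.trans_le ((min_le_right _ _).trans (min_le_left _ _))
      have hδn : δ < 1 / ((n : ℝ) + 1) :=
        hδlt.trans_le ((min_le_right _ _).trans (min_le_right _ _))
      have hδ1 : δ < 1 := by
        have : 1 / (R + 2) ≤ 1 := by
          rw [div_le_one (by positivity)]; linarith
        exact hδR.trans_le this
      have htriv : S n y = 0 := by simp [hS, hn]
      rw [htriv, dist_comm, Real.dist_eq, sub_zero]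
      set m : ℕ := ⌈1 / δ ^ 2⌉₊ with hm
      have hm_ge : 1 / δ ^ 2 ≤ (m : ℝ) := Nat.le_ceil _
      have hδsq : δ ^ 2 ≤ δ := by nlinarith
      have h_inv : 1 / δ ≤ 1 / δ ^ 2 := one_div_le_one_div_of_le (by positivity) hδsq
      have hnm : n ≤ m := by
        have h1 : ((n : ℝ) + 1) * δ < 1 := by
          rwa [lt_div_iff₀ (by positivity), mul_comm] at hδn
        have h2 : (n : ℝ) < 1 / δ := by
          rw [lt_div_iff₀ hδpos]; nlinarith
        have h3 : (n : ℝ) ≤ m := (h2.le.trans h_inv).trans hm_ge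
        exact_mod_cast h3
      have hyR : ∀ i k, |y i k| ≤ R := by
        intro i k
        have h1 : |y i k| ≤ ‖y i‖ := by
          simpa [Real.norm_eq_abs] using PiLp.norm_apply_le (y i) k
        have h2 : ‖y i‖ ≤ ‖y‖ := norm_le_pi_norm y i
        have h3 : ‖y‖ ≤ ‖x‖ + dist y x := by
          have := norm_le_norm_add_norm_sub' y x
          rwa [← dist_eq_norm] at this
        have h4 : dist y x < 1 := Metric.mem_ball.1 hy
        linarith
      have hRδ : R / δ + 1 ≤ (m : ℝ) := by
        have h1 : R * δ + δ ^ 2 ≤ 1 := by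
          have hδR' : δ * (R + 2) < 1 := by
            rwa [lt_div_iff₀ (by positivity)] at hδR
          nlinarith
        have h2 : R / δ + 1 ≤ 1 / δ ^ 2 := by
          rw [div_add_one (ne_of_gt hδpos), div_le_div_iff₀ hδpos (by positivity)]
          nlinarith
        exact h2.trans hm_ge
      have hcoord : ∀ i k, latticeApprox δ (y i) k ∈ Set.Icc (-(m : ℤ)) m := by
        intro i k
        rw [latticeApprox_apply]
        have hb : |y i k / δ| ≤ R / δ := by
          rw [abs_div, abs_of_pos hδpos]
          exact div_le_div_of_nonneg_right (hyR i k) hδpos.le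
        obtain ⟨hb1, hb2⟩ := abs_le.1 hb
        have hfl1 : (⌊y i k / δ⌋ : ℝ) ≤ y i k / δ := Int.floor_le _
        have hfl2 : y i k / δ - 1 < (⌊y i k / δ⌋ : ℝ) := Int.sub_one_lt_floor _
        constructor
        · have : (-(m : ℝ)) ≤ (⌊y i k / δ⌋ : ℝ) := by linarith
          exact_mod_cast this
        · have : (⌊y i k / δ⌋ : ℝ) ≤ (m : ℝ) := by linarith
          exact_mod_cast this
      have hG : |G n (fun i => latticeApprox δ (y i))| ≤ B m := abs_le_B hnm _ hcoord
      have hBm := B_pos m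
      have hρδ : ρ δ = δ / B m := by simp only [hρ, hm]
      rw [rescaledCorrelator_apply, abs_mul, abs_pow, hρδ, abs_of_pos (div_pos hδpos hBm)]
      have hq0 : 0 ≤ δ / B m := (div_pos hδpos hBm).le
      have hq1 : δ / B m ≤ 1 := by
        rw [div_le_one hBm]; exact hδ1.le.trans (one_le_B m)
      calc (δ / B m) ^ n * |G n fun i => latticeApprox δ (y i)|
          ≤ (δ / B m) * B m := mul_le_mul (pow_le_of_le_one hq0 hq1 hn) hG (abs_nonneg _) hq0
        _ = δ := div_mul_cancel₀ δ hBm.ne'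
        _ < ε := hδε
  · -- degeneracy: `S 2 ≡ 0`
    intro h
    let e : EuclideanSpace ℝ (Fin d) := EuclideanSpace.single ⟨0, hd⟩ 1
    have he : e ≠ 0 := by
      intro h0
      have : ‖e‖ = 1 := by simp [e]
      rw [h0, norm_zero] at this
      exact zero_ne_one this
    have hx : (![0, e] : Fin 2 → EuclideanSpace ℝ (Fin d)) ∈ NonCoincident d 2 := by
      rw [mem_nonCoincident]
      intro i j hij
      fin_cases i <;> fin_cases j
      · rfl
      · exact absurd (hij.symm : e = 0) he
      · exact absurd (hij : e = 0) he
      · rfl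
    have := h _ hx
    simp [hS] at this

/-- Refutes `stmt-CriticalPhenomena-0666` (crux (ND) of route IsingCFTData), exact signature
negated: the killing renormalisation gives a degenerate pointwise scaling limit of the critical
Ising correlators on `ℤ³`. [folklore] -/
theorem not_IsingCFTData_ND :
    ¬ (∀ (ρ : ℝ → ℝ) (S : Literature.Probability.LatticeModels.CorrFamily 3), (∀ δ ∈ Set.Ioc (0:ℝ) 1, 0 < ρ δ) → Literature.Probability.LatticeModels.HasPointwiseScalingLimit (Literature.Probability.LatticeModels.criticalCorr 3) ρ S → Literature.Probability.LatticeModels.IsNondegenerateTwoPoint S ∧ Literature.Probability.LatticeModels.HasNontrivialU4 S) := by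
  intro h
  obtain ⟨ρ, S, hρ, hlim, hnd⟩ := exists_degenerate_scalingLimit (criticalCorr 3) three_pos
  exact hnd (h ρ S hρ hlim).1

/-- Refutes `stmt-CriticalPhenomena-0663` (thesis `X_I2 = (CFT) ∧ (ND)` of route IsingCFTData),
exact signature negated: its second conjunct (ND) is false as typed. [folklore] -/
theorem not_IsingCFTData_thesis :
    ¬ (Literature.MathematicalPhysics.QuantumFieldTheory.CritIsing3DIsCFT ∧ (∀ (ρ : ℝ → ℝ) (S : Literature.Probability.LatticeModels.CorrFamily 3), (∀ δ ∈ Set.Ioc (0:ℝ) 1, 0 < ρ δ) → Literature.Probability.LatticeModels.HasPointwiseScalingLimit (Literature.Probability.LatticeModels.criticalCorr 3) ρ S → Literature.Probability.LatticeModels.IsNondegenerateTwoPoint S ∧ Literature.Probability.LatticeModels.HasNontrivialU4 S)) :=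
  fun h => not_IsingCFTData_ND h.2


/-! ### Degenerate companions of ANY scaling limit (refuter g3-3, independent mechanism)

A second, structural reason why `(ND)` cannot quantify over all renormalisations: whenever
`(ρ, S)` is a pointwise scaling limit of a lattice family `G`, so is `(δ ↦ δ·ρ(δ), S')` with
`S' n ≡ 0` for `n ≥ 1` (`hasPointwiseScalingLimit_degenerate`). Hence every ∃-statement producing
a limit (`CritIsing3DIsCFT`, `CritIsing3DEuclideanLimit`, the summit conjunct
`Ising3DConformalLimit` itself) implies `¬ (ND)`; a re-typed `(ND)` must hypothesise
non-degeneracy data on `S` (e.g. `∃ x ∈ NonCoincident 3 2, 0 < S 2 x`, cf. stmt-0667), not merely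
constrain the growth of `ρ`. -/

/-- At a fixed mesh `δ > 0` the rescaled correlator `y ↦ ρ(δ)ⁿ G n ([y₁/δ], …, [yₙ/δ])` is
bounded on the unit ball around any configuration `x`: the lattice approximations of the ball
range over a finite box of `(ℤ^d)ⁿ`. [folklore] -/
theorem rescaledCorrelator_bounded_on_ball (G : LatticeCorrFamily d) (ρ : ℝ → ℝ) (n : ℕ)
    {δ : ℝ} (hδ : 0 < δ) (x : Fin n → EuclideanSpace ℝ (Fin d)) :
    ∃ M : ℝ, ∀ y ∈ Metric.ball x 1, |rescaledCorrelator G ρ n δ y| ≤ M := by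
  classical
  let T : Finset (Fin n → Site d) :=
    Fintype.piFinset fun i => Fintype.piFinset fun j =>
      Finset.Icc ⌊(x i j - 1) / δ⌋ ⌊(x i j + 1) / δ⌋
  refine ⟨|ρ δ| ^ n * ∑ z ∈ T, |G n z|, fun y hy => ?_⟩
  have hmem : (fun i => latticeApprox δ (y i)) ∈ T := by
    simp only [T, Fintype.mem_piFinset, Finset.mem_Icc, latticeApprox_apply]
    intro i j
    have h1 : |y i j - x i j| < 1 := by
      have hyx : dist y x < 1 := Metric.mem_ball.1 hy
      calc |y i j - x i j| = dist (y i j) (x i j) := (Real.dist_eq _ _).symm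
        _ ≤ dist (y i) (x i) := PiLp.dist_apply_le (y i) (x i) j
        _ ≤ dist y x := dist_le_pi_dist y x i
        _ < 1 := hyx
    obtain ⟨hl, hr⟩ := abs_lt.1 h1
    constructor
    · exact Int.floor_mono (div_le_div_of_nonneg_right (by linarith) hδ.le)
    · exact Int.floor_mono (div_le_div_of_nonneg_right (by linarith) hδ.le)
  rw [rescaledCorrelator_apply, abs_mul, abs_pow]
  gcongr
  exact Finset.single_le_sum (f := fun z => |G n z|) (fun _ _ => abs_nonneg _) hmem

/-- **Degenerate renormalisations.** If `(ρ, S)` is a pointwise scaling limit of the lattice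
family `G`, then so is `(δ ↦ δ·ρ(δ), S')` with `S' 0 = S 0` and `S' n ≡ 0` for `n ≥ 1`: the
limit `S n` is locally bounded on non-coincident configurations (uniform closeness to one
piecewise-constant `ρ(δ₀)ⁿ G n ([·/δ₀])`, bounded on balls by
`rescaledCorrelator_bounded_on_ball`), so `δⁿ · ρ(δ)ⁿ G n ([·/δ]) → 0` locally uniformly.
This is the mechanism behind the refutations below. [folklore] -/
theorem hasPointwiseScalingLimit_degenerate {G : LatticeCorrFamily d} {ρ : ℝ → ℝ}
    {S : CorrFamily d} (h : HasPointwiseScalingLimit G ρ S) :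
    HasPointwiseScalingLimit G (fun δ => δ * ρ δ) (fun n x => if n = 0 then S n x else 0) := by
  intro n
  rcases n with _ | k
  · have : rescaledCorrelator G (fun δ => δ * ρ δ) 0 = rescaledCorrelator G ρ 0 := by
      funext δ x; simp [rescaledCorrelator_apply]
    rw [this]; simpa using h 0
  · set n := k + 1 with hn
    show TendstoLocallyUniformlyOn (rescaledCorrelator G (fun δ => δ * ρ δ) n) (fun _ => (0:ℝ))
      (𝓝[>] (0 : ℝ)) (NonCoincident d n)
    rw [Metric.tendstoLocallyUniformlyOn_iff]
    intro ε hε x hx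
    obtain ⟨t, ht, hev⟩ := (Metric.tendstoLocallyUniformlyOn_iff.1 (h n)) 1 one_pos x hx
    obtain ⟨δ₀, hδ₀pos, hδ₀⟩ :=
      ((eventually_mem_nhdsWithin (a := (0:ℝ)) (s := Set.Ioi 0)).and hev).exists
    obtain ⟨M, hM⟩ := rescaledCorrelator_bounded_on_ball G ρ n (Set.mem_Ioi.1 hδ₀pos) x
    have hSbd : ∀ y ∈ t ∩ Metric.ball x 1, |S n y| ≤ 1 + M := by
      rintro y ⟨hyt, hyb⟩
      have h1 := hδ₀ y hyt
      have h2 := hM y hyb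
      rw [Real.dist_eq] at h1
      have h3 := abs_add_le (S n y - rescaledCorrelator G ρ n δ₀ y)
        (rescaledCorrelator G ρ n δ₀ y)
      rw [sub_add_cancel] at h3
      linarith
    refine ⟨t ∩ Metric.ball x 1,
      inter_mem ht (mem_nhdsWithin_of_mem_nhds (Metric.ball_mem_nhds x one_pos)), ?_⟩
    have hK : 0 < 2 + M := by
      have := hM x (Metric.mem_ball_self one_pos)
      linarith [abs_nonneg (rescaledCorrelator G ρ n δ₀ x)]
    have hsmall : ∀ᶠ δ in 𝓝[>] (0:ℝ), δ ∈ Set.Ioo 0 (min 1 (ε / (2 + M))) :=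
      Ioo_mem_nhdsGT (lt_min one_pos (div_pos hε hK))
    filter_upwards [hev, hsmall] with δ hδ1 hδ2 y hy
    obtain ⟨hδpos, hδlt⟩ := hδ2
    have hδ1' : δ < 1 := lt_of_lt_of_le hδlt (min_le_left _ _)
    have hδε : δ < ε / (2 + M) := lt_of_lt_of_le hδlt (min_le_right _ _)
    have key : rescaledCorrelator G (fun δ => δ * ρ δ) n δ y =
        δ ^ n * rescaledCorrelator G ρ n δ y := by
      rw [rescaledCorrelator_apply, rescaledCorrelator_apply, mul_pow, mul_assoc]
    rw [Real.dist_eq, key, zero_sub, abs_neg, abs_mul, abs_pow, abs_of_pos hδpos]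
    have hF : |rescaledCorrelator G ρ n δ y| ≤ 2 + M := by
      have h1 := hδ1 y hy.1
      rw [Real.dist_eq] at h1
      have h2 := hSbd y hy
      have h3 := abs_sub_le (rescaledCorrelator G ρ n δ y) (S n y) 0
      rw [sub_zero, sub_zero, abs_sub_comm] at h3
      linarith
    have hδn : δ ^ n ≤ δ := pow_le_of_le_one hδpos.le hδ1'.le (Nat.succ_ne_zero k)
    calc δ ^ n * |rescaledCorrelator G ρ n δ y| ≤ δ * (2 + M) := by gcongr
      _ < ε / (2 + M) * (2 + M) := by gcongr
      _ = ε := div_mul_cancel₀ ε hK.ne'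

/-- Conditional refutation of stmt-CriticalPhenomena-0666 `(ND)`: if the critical Ising
correlators on `ℤ³` admit *some* pointwise scaling limit `(ρ, S)` with `ρ > 0` on `(0,1]`, then
`(ND)` ("every scaling limit, for every renormalisation, is non-degenerate with `U₄ ≢ 0`") is
false — the degenerate pair `(δρ, S')` of `hasPointwiseScalingLimit_degenerate` is a scaling
limit with `S' 2 ≡ 0` and `U₄^{S'} ≡ 0`. [folklore] -/
theorem not_ND_of_exists_hasPointwiseScalingLimit
    (hex : ∃ (ρ : ℝ → ℝ) (S : Literature.Probability.LatticeModels.CorrFamily 3), (∀ δ ∈ Set.Ioc (0:ℝ) 1, 0 < ρ δ) ∧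
      Literature.Probability.LatticeModels.HasPointwiseScalingLimit (Literature.Probability.LatticeModels.criticalCorr 3) ρ S) :
    ¬ (∀ (ρ : ℝ → ℝ) (S : Literature.Probability.LatticeModels.CorrFamily 3), (∀ δ ∈ Set.Ioc (0:ℝ) 1, 0 < ρ δ) → Literature.Probability.LatticeModels.HasPointwiseScalingLimit (Literature.Probability.LatticeModels.criticalCorr 3) ρ S → Literature.Probability.LatticeModels.IsNondegenerateTwoPoint S ∧ Literature.Probability.LatticeModels.HasNontrivialU4 S) := by
  intro hND
  obtain ⟨ρ, S, hρ, hlim⟩ := hex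
  have hρ' : ∀ δ ∈ Set.Ioc (0:ℝ) 1, 0 < δ * ρ δ := fun δ hδ => mul_pos hδ.1 (hρ δ hδ)
  obtain ⟨-, x, -, hx⟩ := hND _ _ hρ' (hasPointwiseScalingLimit_degenerate hlim)
  exact hx (by simp [limitConnectedFour])

/-- The degenerate limit also violates non-degeneracy (the first conclusion of `(ND)`), not only
`U₄ ≢ 0`: given any scaling limit, "every scaling limit is non-degenerate" is false.
[folklore] -/
theorem not_forall_isNondegenerateTwoPoint_of_exists_hasPointwiseScalingLimit
    (hex : ∃ (ρ : ℝ → ℝ) (S : Literature.Probability.LatticeModels.CorrFamily 3), (∀ δ ∈ Set.Ioc (0:ℝ) 1, 0 < ρ δ) ∧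
      Literature.Probability.LatticeModels.HasPointwiseScalingLimit (Literature.Probability.LatticeModels.criticalCorr 3) ρ S) :
    ¬ (∀ (ρ : ℝ → ℝ) (S : Literature.Probability.LatticeModels.CorrFamily 3), (∀ δ ∈ Set.Ioc (0:ℝ) 1, 0 < ρ δ) →
      Literature.Probability.LatticeModels.HasPointwiseScalingLimit (Literature.Probability.LatticeModels.criticalCorr 3) ρ S →
      Literature.Probability.LatticeModels.IsNondegenerateTwoPoint S) := by
  intro hND
  obtain ⟨ρ, S, hρ, hlim⟩ := hex
  have hρ' : ∀ δ ∈ Set.Ioc (0:ℝ) 1, 0 < δ * ρ δ := fun δ hδ => mul_pos hδ.1 (hρ δ hδ)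
  obtain ⟨e, he0⟩ : ∃ e : EuclideanSpace ℝ (Fin 3), e ≠ 0 :=
    ⟨EuclideanSpace.single 0 1, by rw [← norm_ne_zero_iff]; simp⟩
  have hinj : (![0, e] : Fin 2 → EuclideanSpace ℝ (Fin 3)) ∈ NonCoincident 3 2 := by
    rw [mem_nonCoincident]
    refine Fin.cons_injective_iff.2 ⟨?_, Function.injective_of_subsingleton _⟩
    simpa using he0.symm
  have := hND _ _ hρ' (hasPointwiseScalingLimit_degenerate hlim) _ hinj
  simp at this

/-- The summit conjunct itself refutes `(ND)`: `Ising3DConformalLimit` supplies a scaling limit,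
whence `¬ (ND)`. So no route of the form `… ∧ (ND) → Ising3DConformalLimit` can have a true
antecedent. [folklore] -/
theorem not_ND_of_ising3DConformalLimit (hI : Ising3DConformalLimit) :
    ¬ (∀ (ρ : ℝ → ℝ) (S : Literature.Probability.LatticeModels.CorrFamily 3), (∀ δ ∈ Set.Ioc (0:ℝ) 1, 0 < ρ δ) → Literature.Probability.LatticeModels.HasPointwiseScalingLimit (Literature.Probability.LatticeModels.criticalCorr 3) ρ S → Literature.Probability.LatticeModels.IsNondegenerateTwoPoint S ∧ Literature.Probability.LatticeModels.HasNontrivialU4 S) := by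
  obtain ⟨ρ, -, S, hρ, -, hlim, -⟩ := hI
  exact not_ND_of_exists_hasPointwiseScalingLimit ⟨ρ, S, hρ, hlim⟩


/-! ### General form (refuter g4-7): the typing defect is model- and dimension-agnostic -/

/-- **No lattice family has only non-degenerate scaling limits.** For every lattice correlation
family `G` on `ℤ^d`, `d ≥ 1`, the statement "every positive renormalisation `ρ` on `(0,1]` with a
pointwise scaling limit `S` yields a non-degenerate two-point function" is false: the killing
renormalisation of `exists_degenerate_scalingLimit` produces a limit with `S 2 ≡ 0`. This is the
`d`- and model-independent form of `not_IsingCFTData_ND`; any re-typing of an `(ND)`-type crux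
(in any dimension, for any model) must therefore hypothesise non-degeneracy data on `S` rather
than quantify over all `ρ > 0`. [folklore] -/
theorem not_forall_isNondegenerateTwoPoint (G : LatticeCorrFamily d) (hd : 0 < d) :
    ¬ (∀ (ρ : ℝ → ℝ) (S : CorrFamily d), (∀ δ ∈ Set.Ioc (0:ℝ) 1, 0 < ρ δ) →
      HasPointwiseScalingLimit G ρ S → IsNondegenerateTwoPoint S) := by
  intro h
  obtain ⟨ρ, S, hρ, hlim, hnd⟩ := exists_degenerate_scalingLimit G hd
  exact hnd (h ρ S hρ hlim)

/-- The same with any additional conclusion `P S` conjoined (e.g. `HasNontrivialU4 S`, conformal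
covariance, OS axioms): "every scaling limit of `G` under every positive renormalisation is
non-degenerate and satisfies `P`" is false for every lattice family `G` on `ℤ^d`, `d ≥ 1`.
Instantiated at `G = criticalCorr 3`, `P = HasNontrivialU4` this is `not_IsingCFTData_ND`.
[folklore] -/
theorem not_forall_isNondegenerateTwoPoint_and (G : LatticeCorrFamily d) (hd : 0 < d)
    (P : CorrFamily d → Prop) :
    ¬ (∀ (ρ : ℝ → ℝ) (S : CorrFamily d), (∀ δ ∈ Set.Ioc (0:ℝ) 1, 0 < ρ δ) →
      HasPointwiseScalingLimit G ρ S → IsNondegenerateTwoPoint S ∧ P S) :=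
  fun h => not_forall_isNondegenerateTwoPoint G hd fun ρ S hρ hlim => (h ρ S hρ hlim).1

end

end CriticalPhenomena.IsingCFTData
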